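import Summits.AtomisticToContinuum.Crystallization.Theorems.GrainPercolationDialCrossCeiling
import Summits.AtomisticToContinuum.Crystallization.Theorems.ChessboardParticlePlanesLjLaminarWindowsMinDistance
import Summits.AtomisticToContinuum.Crystallization.Theorems.LoopTunnelDialCurrencyBridge
import Summits.AtomisticToContinuum.Crystallization.Theorems.LoopTunnelDialLocalSurgery
import Literature.MathematicalPhysics.StatisticalMechanics.StablePotentialsProofs

/-!
# LoopTunnelDial — the SIEVE / SURGERY CURRENCY of crux `PocketCase` and the DEPTH BRIDGE (helper, `--supports stmt-27294`)

Route `LoopTunnelDial` (Crystallization), crux `PocketCase` (stmt-AtomisticToContinuum-27294), registered skeleton v5.1 «pocket-certificate»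
(sha 0b0eb4ae…, stubs `stub_improvableNearPocket` / `stub_improvableFarPocket`).  This file (decomp-a2c lens 5 «finite/base range +
asymptotic regime + bridging lemma», generation 17; cell critic row 207: «land the shared sieve/surgery currency») lands, complete and over
LANDED modules only, the VOCABULARY that the registered skeleton, the banked line v6 «far at infinity» and the preview v7 «depth dial» all
state verbatim — so that later Theorems files (K1–K3 of generation 16, the near/far certificates) can cite it BY NAME instead of re-copying
it —, together with generation 17's PROVED depth bridge.  Nothing here is registered or re-typed: the skeleton's texts are recovered from
these definitions by `Iff.rfl` in the line files.

* §1 THE SIEVE (lens-1 SieveDepthLadder §13 verbatim): `UniformlyTightR ℓ δ d y j` (δ-quasi-twelve certificate at sieve radius `ℓ`),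
  `certSet`, `farSet ℓ δ s` (no `ℓ`-certified particle within `s`).
* §2 THE SURGERY CURRENCY (generation 14/15 verbatim): `Improvable e η R y c` (a local surgery of radius `R` about `y c` improving the grand
  potential at chemical potential `e` by `η`, particle budget `⌈64R³⌉`; the tree's `LoopTunnelDialLocalSurgery` states the same predicate
  unfolded), the ONE-RADIUS DOOR `FarSurgeryCertificate N₀ s₀ g` / `FarCertified` (v5.1's far half: `FarCertified → ImprovableFarPocket` is
  proved in the skeleton file).
* §3 THE DEPTH DIAL (generation 17): `DeepFar s y c` (every particle within `s + 6` of `y c` is `(2,3/50,6)`-far AND the `s`-ball holds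
  `≥ s³` particles), `CanonImprovable r y c` (SAME particle number, agrees outside the closed `r`-ball, STRICTLY lower energy — no chemical
  potential), `DeepFarCanon r s` (GS-free: every injective `7/10`-separated configuration is canonically `r`-improvable about every `s`-deep-far
  particle), `ShallowFar`, `ThinSurgeryCertificate` / `ThinCertified s` (the door RESTRICTED to ground states with `s`-shallow far matter).
* §4 KERNELS (all PROVED): ground states are canonically stable for free (`not_canonImprovable_of_isGroundState`: `𝓔(y) = E(N) ≤ 𝓔(z)`),
  hence DEEP forbids deep far matter in ground states and THE BRIDGE `farCertified_of_deep_thin : DeepFarCanon r s → ThinCertified s →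
  FarCertified`; `thinCertified_of_farCertified` (THIN is a restriction of the door); reading lemmas (`not_deepFar_iff`,
  `not_deepFar_of_card_lt` — no configuration on `< s³` particles has an `s`-deep-far particle —, monotonicity in `r`, canonical ⊂ grand
  currency `exists_improvable_of_canonImprovable`); canonical ORDER ONE: `canonImprovable_of_move` (relocating one particle) and RUNG 0
  `canonImprovable_of_hotSite_clearPoint` (a particle of positive site energy and a `9/10`-clear empty point within `r` ⟹ canonically
  `r`-improvable — the `ΔN = 0` twin of `LoopTunnelDialOrderOneRung`'s priced kernels).

All `[folklore]` bookkeeping over Literature's `interactionEnergy` / `siteEnergy` / `IsGroundState` / `lennardJones` and the landed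
`GrainPercolationDialCrossCeiling.ballChunk`; tree facts used: `groundStateEnergy_lennardJones_le`,
`LjLaminarWindowsSketch.lennardJones_groundState_dist_ge_seven_tenths`, `interactionEnergy_eq_succAbove_add_siteEnergy`,
`LoopTunnelDialLocalSurgery.interactionEnergy_cons`.
-/

noncomputable section

namespace Summit.AtomisticToContinuum.Crystallization.Theorems.LoopTunnelDialSieveCurrency

open scoped BigOperators Classical
open Literature.MathematicalPhysics.StatisticalMechanics
open Summit.AtomisticToContinuum.Crystallization.Theorems.GrainPercolationDialCrossCeiling (E3 ballChunk)

/-! ## §1 The sieve (lens-1 SieveDepthLadder §13, verbatim) -/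

/-- `UniformlyTightR ℓ δ d y j`: the lineage's δ-QUASI-TWELVE sieve at SIEVE RADIUS `ℓ` — common scale `d ∈ [3/4, 6/5]`, `d`-separation
on `B(y j, ℓ+1)`, and twelve neighbours within `(1+δ)d` for every particle of `B(y j, ℓ)`. [lens-1 §13, verbatim; folklore] -/
def UniformlyTightR (ℓ δ d : ℝ) {N : ℕ} (y : Fin N → EuclideanSpace ℝ (Fin 3)) (j : Fin N) : Prop :=
  3 / 4 ≤ d ∧ d ≤ 6 / 5 ∧ (∀ k l : Fin N, k ≠ l → dist (y k) (y j) ≤ ℓ + 1 → dist (y l) (y j) ≤ ℓ + 1 → d ≤ dist (y k) (y l)) ∧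
    (∀ k : Fin N, dist (y k) (y j) ≤ ℓ → 12 ≤ (Finset.univ.filter fun l => l ≠ k ∧ dist (y l) (y k) ≤ (1 + δ) * d).card)

/-- `certSet ℓ δ y` — the `ℓ`-CERTIFIED particles. [lens-1 §13, verbatim] -/
def certSet (ℓ δ : ℝ) {N : ℕ} (y : Fin N → EuclideanSpace ℝ (Fin 3)) : Finset (Fin N) :=
  Finset.univ.filter fun j : Fin N => ∃ d : ℝ, UniformlyTightR ℓ δ d y j

/-- `farSet ℓ δ s y` — the `s`-FAR particles at sieve radius `ℓ`: NO `ℓ`-certified particle within distance `s`. [lens-1 §13, verbatim] -/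
def farSet (ℓ δ s : ℝ) {N : ℕ} (y : Fin N → EuclideanSpace ℝ (Fin 3)) : Finset (Fin N) :=
  Finset.univ.filter fun i : Fin N => ∀ j : Fin N, j ∈ certSet ℓ δ y → s < dist (y i) (y j)

/-! ## §2 The surgery currency and the one-radius door (generations 14/15, verbatim) -/

/-- **LOCAL SURGERY.** `Improvable e η R y c`: some injective configuration `z` on `M` particles which coincides with `y` as a point set
outside the closed `R`-ball about the particle `y c`, with `|M − N| ≤ ⌈64R³⌉`, improving the grand potential at chemical potential `e` by at
least `η`: `𝓔(z) + η ≤ 𝓔(y) + e·(M − N)`.  (`LoopTunnelDialLocalSurgery` states the same predicate unfolded.) -/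
def Improvable (e η R : ℝ) {N : ℕ} (y : Fin N → E3) (c : Fin N) : Prop :=
  ∃ (M : ℕ) (z : Fin M → E3), Function.Injective z ∧
    (∀ k : Fin N, R < dist (y k) (y c) → y k ∈ Set.range z) ∧
    (∀ l : Fin M, R < dist (z l) (y c) → z l ∈ Set.range y) ∧
    N ≤ M + ⌈64 * R ^ 3⌉₊ ∧ M ≤ N + ⌈64 * R ^ 3⌉₊ ∧
    interactionEnergy lennardJones z + η ≤ interactionEnergy lennardJones y + e * ((M : ℝ) - N)

section Door
open Summit.AtomisticToContinuum.Crystallization.Theorems.ChargedEnergyGapNegative (eStar)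

/-- **`FarSurgeryCertificate N₀ s₀ g`** — every Lennard-Jones ground state on `N ≥ N₀` particles that HAS a `(2, 3/50, 6)`-far particle admits
a radius-`s₀` local surgery about SOME particle improving the grand potential at chemical potential `e⋆` by at least `g`. -/
def FarSurgeryCertificate (N₀ : ℕ) (s₀ g : ℝ) : Prop :=
  ∀ N : ℕ, N₀ ≤ N → ∀ y : Fin N → E3, IsGroundState lennardJones y →
    (∃ i : Fin N, i ∈ farSet 2 (3 / 50) 6 y) → ∃ c : Fin N, Improvable eStar g s₀ y c

/-- **The ONE-RADIUS DOOR `FarCertified`**: SOME threshold, SOME radius and SOME margin certify every large ground state with far matter. -/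
def FarCertified : Prop :=
  ∃ N₀ : ℕ, ∃ s₀ g : ℝ, 0 ≤ s₀ ∧ 0 < g ∧ FarSurgeryCertificate N₀ s₀ g

end Door

/-! ## §3–§4 The depth dial and its kernels (generation 17) -/

section Generation17

open Summit.AtomisticToContinuum.Crystallization.Theorems.ChargedEnergyGapNegative (eStar)
open Summit.AtomisticToContinuum.Crystallization.Theorems.LjLaminarWindowsSketch (lennardJones_groundState_dist_ge_seven_tenths)
open Summit.AtomisticToContinuum.Crystallization.Theorems.LoopTunnelDialLocalSurgery (interactionEnergy_cons)


variable {N : ℕ}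

/-- **`DeepFar s y c`** — particle `c` is `s`-DEEP-FAR in `y`: every particle within distance `s + 6` of `y c` is `(2, 3/50, 6)`-far
(lens-1's sieve verbatim: no `2`-certified particle within `6`), AND the closed `s`-ball about `y c` holds at least `s³` particles
(close packing holds `≈ 4.6 s³`; the filling clause says «deep inside far MATTER»: at `s = 32` no configuration on fewer than `32768`
particles has a deep-far particle, so the icosahedral / decahedral Lennard-Jones cluster windows never enter). -/
def DeepFar (s : ℝ) {N : ℕ} (y : Fin N → E3) (c : Fin N) : Prop :=
  (∀ k : Fin N, dist (y k) (y c) ≤ s + 6 → k ∈ farSet 2 (3 / 50) 6 y) ∧ s ^ 3 ≤ ((ballChunk y c s).card : ℝ)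

/-- **CANONICAL LOCAL SURGERY `CanonImprovable r y c`** — an injective configuration on the SAME number of particles which coincides with
`y` as a point set outside the closed `r`-ball about the particle `y c` and has STRICTLY lower energy.  No chemical potential, no `e⋆`,
no margin, no particle budget: the `ΔN = 0` slice of the lineage's `Improvable` (`exists_improvable_of_canonImprovable`). -/
def CanonImprovable (r : ℝ) {N : ℕ} (y : Fin N → E3) (c : Fin N) : Prop :=
  ∃ z : Fin N → E3, Function.Injective z ∧
    (∀ k : Fin N, r < dist (y k) (y c) → y k ∈ Set.range z) ∧
    (∀ l : Fin N, r < dist (z l) (y c) → z l ∈ Set.range y) ∧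
    interactionEnergy lennardJones z < interactionEnergy lennardJones y

/-- **DEEP · `DeepFarCanon r s`** [GS-free · `μ`-free · `e⋆`-free · `N`-free · INSTRUMENTABLE (census ask (h): the CANONICAL bite table) ·
certifiable per specimen by interval arithmetic · BARRIER TetrahedralFrustration PLACED (card)]: every injective `7/10`-separated finite
configuration in `ℝ³` is canonically improvable within radius `r` about every `s`-deep-far particle.  Filed at `(r, s) = (32, 32)`;
monotone in `r` (`deepFarCanon_mono`). -/
def DeepFarCanon (r s : ℝ) : Prop :=
  ∀ (N : ℕ) (y : Fin N → E3), Function.Injective y → (∀ i j : Fin N, i ≠ j → (7 : ℝ) / 10 ≤ dist (y i) (y j)) →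
    ∀ c : Fin N, DeepFar s y c → CanonImprovable r y c

/-- **`ShallowFar s y`** — the far matter of `y` is NOWHERE `s`-deep: every far particle has a NON-far particle within `s + 6` or an
`s`-ball holding fewer than `s³` particles (`not_deepFar_iff`). -/
def ShallowFar (s : ℝ) {N : ℕ} (y : Fin N → E3) : Prop :=
  ∀ i : Fin N, i ∈ farSet 2 (3 / 50) 6 y → ¬ DeepFar s y i

/-- **THIN · `ThinSurgeryCertificate s N₀ s₀ g`** — generation 15's door `FarSurgeryCertificate N₀ s₀ g` RESTRICTED to ground states with
`s`-shallow far matter (films, filaments and pockets of far matter within `s + 6` of non-far matter; tenuous far matter). -/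
def ThinSurgeryCertificate (s : ℝ) (N₀ : ℕ) (s₀ g : ℝ) : Prop :=
  ∀ N : ℕ, N₀ ≤ N → ∀ y : Fin N → E3, IsGroundState lennardJones y → ShallowFar s y →
    (∃ i : Fin N, i ∈ farSet 2 (3 / 50) 6 y) → ∃ c : Fin N, Improvable eStar g s₀ y c

/-- **THIN · `ThinCertified s`** [DECLARED RESIDUAL · WEAKER than `FarCertified` (`thinCertified_of_farCertified`) · asymptotic regime:
`N₀` absorbs the finite-cluster windows · BARRIER-core TetrahedralFrustration only through far INTERFACE matter at coexistence]:
SOME threshold, radius and margin certify every large ground state whose far matter is non-empty and `s`-shallow.  Filed at `s = 32`. -/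
def ThinCertified (s : ℝ) : Prop :=
  ∃ N₀ : ℕ, ∃ s₀ g : ℝ, 0 ≤ s₀ ∧ 0 < g ∧ ThinSurgeryCertificate s N₀ s₀ g

/-! ### §G17.1 The bridge: ground states are canonically stable for free -/

/-- **Ground states are CANONICALLY STABLE at every radius (PROVED, three lines):** `𝓔(y) = E(N) ≤ 𝓔(z)`. -/
theorem not_canonImprovable_of_isGroundState {y : Fin N → E3} (hy : IsGroundState lennardJones y) (r : ℝ) (c : Fin N) :
    ¬ CanonImprovable r y c := by
  rintro ⟨z, hz, -, -, hlt⟩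
  have h := groundStateEnergy_lennardJones_le (d := 3) hz
  rw [← hy.2] at h
  exact absurd hlt (not_lt.2 h)

/-- **DEEP forbids deep far matter in ground states (PROVED):** under `DeepFarCanon r s` no Lennard-Jones ground state (any `N`) has an
`s`-deep-far particle. -/
theorem not_deepFar_of_isGroundState {r s : ℝ} (hD : DeepFarCanon r s) {y : Fin N → E3} (hy : IsGroundState lennardJones y)
    (c : Fin N) : ¬ DeepFar s y c := fun hc =>
  not_canonImprovable_of_isGroundState hy r c
    (hD N y hy.1 (fun _ _ hij => lennardJones_groundState_dist_ge_seven_tenths hy hij) c hc)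

/-- Under DEEP every ground state has `s`-SHALLOW far matter. -/
theorem shallowFar_of_isGroundState {r s : ℝ} (hD : DeepFarCanon r s) {y : Fin N → E3} (hy : IsGroundState lennardJones y) :
    ShallowFar s y := fun i _ => not_deepFar_of_isGroundState hD hy i

/-- **THE BRIDGE OF GENERATION 17 (PROVED): DEEP ∧ THIN ⟹ the door `FarCertified`.** -/
theorem farCertified_of_deep_thin {r s : ℝ} (hD : DeepFarCanon r s) (hT : ThinCertified s) : FarCertified := by
  obtain ⟨N₀, s₀, g, hs₀, hg, hT⟩ := hT
  exact ⟨N₀, s₀, g, hs₀, hg, fun N hN y hy hfar => hT N hN y hy (shallowFar_of_isGroundState hD hy) hfar⟩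

/-- **THIN is WEAKER than the door (PROVED):** a restriction of `FarCertified`. -/
theorem thinCertified_of_farCertified (s : ℝ) (h : FarCertified) : ThinCertified s := by
  obtain ⟨N₀, s₀, g, hs₀, hg, h⟩ := h
  exact ⟨N₀, s₀, g, hs₀, hg, fun N hN y hy _ hfar => h N hN y hy hfar⟩

/-! ### §G17.2 Reading lemmas: the shallow world, monotonicity, canonical ⊂ grand currency -/

/-- The THIN world unfolded: a far particle is NOT `s`-deep iff some particle within `s + 6` of it is not far, or its `s`-ball is sparse. -/
theorem not_deepFar_iff {s : ℝ} {y : Fin N → E3} {c : Fin N} :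
    ¬ DeepFar s y c ↔ (∃ k : Fin N, dist (y k) (y c) ≤ s + 6 ∧ k ∉ farSet 2 (3 / 50) 6 y) ∨ ((ballChunk y c s).card : ℝ) < s ^ 3 := by
  unfold DeepFar
  push Not
  constructor
  · intro h
    by_cases h1 : ∃ k : Fin N, dist (y k) (y c) ≤ s + 6 ∧ k ∉ farSet 2 (3 / 50) 6 y
    · exact Or.inl h1
    · push Not at h1
      exact Or.inr (h h1)
  · rintro (⟨k, hk, hkf⟩ | h) hall
    · exact absurd (hall k hk) hkf
    · exact h

/-- A deep-far particle is itself far (take `k = c`, `s + 6 ≥ 0`). -/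
theorem mem_farSet_of_deepFar {s : ℝ} (hs : 0 ≤ s) {y : Fin N → E3} {c : Fin N} (h : DeepFar s y c) :
    c ∈ farSet 2 (3 / 50) 6 y :=
  h.1 c (by rw [dist_self]; linarith)

/-- No configuration on fewer than `s³` particles has an `s`-deep-far particle (the cluster windows never enter DEEP). -/
theorem not_deepFar_of_card_lt {s : ℝ} {y : Fin N → E3} {c : Fin N} (hN : (N : ℝ) < s ^ 3) : ¬ DeepFar s y c := by
  rintro ⟨-, hcard⟩
  have h1 : ((ballChunk y c s).card : ℝ) ≤ N := by
    exact_mod_cast (Finset.card_le_univ (ballChunk y c s)).trans_eq (Finset.card_fin N)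
  linarith

/-- Canonical improvability is MONOTONE in the radius. -/
theorem canonImprovable_mono {r r' : ℝ} (hr : r ≤ r') {y : Fin N → E3} {c : Fin N} (h : CanonImprovable r y c) :
    CanonImprovable r' y c := by
  obtain ⟨z, hz, h1, h2, hlt⟩ := h
  exact ⟨z, hz, fun k hk => h1 k (lt_of_le_of_lt hr hk), fun l hl => h2 l (lt_of_le_of_lt hr hl), hlt⟩

/-- DEEP is MONOTONE in the surgery radius. -/
theorem deepFarCanon_mono {r r' s : ℝ} (hr : r ≤ r') (h : DeepFarCanon r s) : DeepFarCanon r' s :=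
  fun N y hy hsep c hc => canonImprovable_mono hr (h N y hy hsep c hc)

/-- **Canonical ⊂ grand currency (PROVED):** a canonical improvement is an `Improvable` surgery with `M = N` at EVERY chemical potential,
with margin its (positive) energy drop. -/
theorem exists_improvable_of_canonImprovable {r : ℝ} {y : Fin N → E3} {c : Fin N} (h : CanonImprovable r y c) (e : ℝ) :
    ∃ η : ℝ, 0 < η ∧ Improvable e η r y c := by
  obtain ⟨z, hz, h1, h2, hlt⟩ := h
  refine ⟨interactionEnergy lennardJones y - interactionEnergy lennardJones z, sub_pos.2 hlt, N, z, hz, h1, h2,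
    Nat.le_add_right _ _, Nat.le_add_right _ _, ?_⟩
  simp

/-! ### §G17.3 RUNG 0 of DEEP (PROVED, GS-free, `e⋆`-free): canonical order one — MOVES -/

/-- **A MOVE (PROVED):** relocating particle `i` (within `r` of `y c`) to an empty point `h` (within `r` of `y c`) whose insertion sum
against the OTHER particles is below `i`'s site energy is a canonical radius-`r` improvement about `c`. -/
theorem canonImprovable_of_move {r : ℝ} {y : Fin N → E3} (hy : Function.Injective y) {i c : Fin N} {h : E3}
    (hic : dist (y i) (y c) ≤ r) (hh : h ∉ Set.range y) (hhc : dist h (y c) ≤ r)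
    (hlt : (∑ k : Fin N, lennardJones (dist h (y k))) - lennardJones (dist h (y i)) < siteEnergy lennardJones y i) :
    CanonImprovable r y c := by
  cases N with
  | zero => exact i.elim0
  | succ n =>
    have hsplit := interactionEnergy_eq_succAbove_add_siteEnergy lennardJones lennardJones_zero y i
    have hinj' : Function.Injective (y ∘ i.succAbove) := hy.comp Fin.succAbove_right_injective
    have hh' : h ∉ Set.range (y ∘ i.succAbove) := fun ⟨b, hb⟩ => hh ⟨i.succAbove b, hb⟩
    have hinj : Function.Injective (Fin.cons h (y ∘ i.succAbove) : Fin (n + 1) → E3) :=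
      Fin.cons_injective_iff.2 ⟨hh', hinj'⟩
    have hsum : ∑ b : Fin n, lennardJones (dist h ((y ∘ i.succAbove) b)) =
        (∑ k : Fin (n + 1), lennardJones (dist h (y k))) - lennardJones (dist h (y i)) := by
      rw [Fin.sum_univ_succAbove (fun k => lennardJones (dist h (y k))) i]
      simp
    refine ⟨Fin.cons h (y ∘ i.succAbove), hinj, fun k hk => ?_, fun l hl => ?_, ?_⟩
    · have hki : k ≠ i := by
        rintro rfl
        exact absurd hic (not_le.2 hk)
      obtain ⟨b, hb⟩ := Fin.exists_succAbove_eq hki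
      exact ⟨b.succ, by simp [hb]⟩
    · revert hl
      refine Fin.cases ?_ (fun k => ?_) l
      · intro h0
        exact absurd hhc (not_le.2 (by simpa using h0))
      · intro _
        exact ⟨i.succAbove k, by simp⟩
    · rw [interactionEnergy_cons, hsum]
      linarith


/-- **RUNG 0 (PROVED, GS-free, `e⋆`-free): a HOT particle and a CLEAR point make a canonical improvement.**  If particle `i` within `r`
of `y c` has POSITIVE site energy and some empty point `h` within `r` of `y c` is `9/10`-clear of all particles, then `y` is canonically
`r`-improvable about `c`: move `i` to `h` (there it binds by `≤ 0 < 𝓔ⁱ(y)`).  The `ΔN = 0` twin of the landed order-one kernels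
`improvable_of_hotSite` / `improvable_of_cagedHole` (p783069), which need the price `e⋆`. -/
theorem canonImprovable_of_hotSite_clearPoint {r : ℝ} {y : Fin N → E3} (hy : Function.Injective y) {i c : Fin N} {h : E3}
    (hic : dist (y i) (y c) ≤ r) (hhot : 0 < siteEnergy lennardJones y i) (hclear : ∀ k : Fin N, 9 / 10 ≤ dist h (y k))
    (hhc : dist h (y c) ≤ r) : CanonImprovable r y c := by
  have hh : h ∉ Set.range y := by
    rintro ⟨k, hk⟩
    have := hclear k
    rw [← hk, dist_self] at this
    linarith
  refine canonImprovable_of_move hy hic hh hhc ?_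
  have hsub : (∑ k : Fin N, lennardJones (dist h (y k))) - lennardJones (dist h (y i)) =
      ∑ k ∈ Finset.univ.erase i, lennardJones (dist h (y k)) :=
    (Finset.sum_erase_eq_sub (Finset.mem_univ i)).symm
  have hle : ∑ k ∈ Finset.univ.erase i, lennardJones (dist h (y k)) ≤ 0 :=
    Finset.sum_nonpos fun k _ => by
      -- `V_LJ(t) ≤ 0` for `t ≥ 9/10` (`(10/9)⁶ < 2`); the tree proves this in several route cones, re-derived inline here.
      have ht : 9 / 10 ≤ dist h (y k) := hclear k
      have h0 : 0 < dist h (y k) := by linarith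
      have hinv : (dist h (y k))⁻¹ ≤ (9 / 10 : ℝ)⁻¹ := inv_anti₀ (by norm_num) ht
      have hinv0 : 0 ≤ (dist h (y k))⁻¹ := inv_nonneg.2 h0.le
      have h6 : ((dist h (y k))⁻¹) ^ 6 ≤ ((9 / 10 : ℝ)⁻¹) ^ 6 := pow_le_pow_left₀ hinv0 hinv 6
      have h2 : ((9 / 10 : ℝ)⁻¹) ^ 6 < 2 := by norm_num
      have h12 : ((dist h (y k))⁻¹) ^ 12 = (((dist h (y k))⁻¹) ^ 6) ^ 2 := by ring
      show lennardJones (dist h (y k)) ≤ 0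
      unfold lennardJones; rw [h12]; nlinarith [pow_nonneg hinv0 6]
  linarith

end Generation17

end Summit.AtomisticToContinuum.Crystallization.Theorems.LoopTunnelDialSieveCurrency
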